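import Mathlib
import HarnessLib
import Summits.HubbardSuperconductivity.HubbardSuperconductivity.Theorems.KLProgrammeKLRegimeEngineV8DefsG10Hosting

/-!
# Route `KLProgramme` — ENGINE child gen 8 (stmt-HubbardSuperconductivity-20437 `KLRegimeEngineV17F2`): located item «(E2)-TWOSHELL-OPAQUE» (plan g21 (R100)),
# the GENERIC G-amendment `GeoConsts.addTwoShell` — a SYMBOLIC multiple of the uniformly summable two-shell profile added to BOTH bubble gains
# (cell gate-hubbard-kl, seat hubbard-kl-k3c2-p2 g14, ∃-opacity sweep lead)

WHY.  The value lane books the two-shell (above-resolution) part of the slice's ph/pp increments into `phGain`/`ppGain`'s ABOVE branch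
(`klg5_above_of_twoShell`: `a₁, a₂ ≤ 2⁵²`), but the two-shell constants are compactness/`∃`-constants (`kltb_exists_twoShell_bound`; FS-WINDOW §13) —
no numeral.  Exactly as `addShellLog` (relative-family log) and `raiseCF` (iso moments), the cure is a SYMBOLIC amendment of the gains by `A·T_n(ρ)` with
`A` a deferred constant; this file is the A-generic algebra:
* §1 **`klTwoShellProfile n ρ := min(ρ₊/Λₙ, Λₙ/ρ₊) + √klE0·2^{−n}`** (`ρ₊ = max ρ 0`; at `ρ ≥ Λₙ` it dominates the two laws `Λₙ/ρ` and `√Λₙ = √klE0·2^{−n}`),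
  nonnegativity, the readings `klScale_div_le_klTwoShellProfile` / `sqrt_klScale_le_klTwoShellProfile`, **UNIFORM SUMMABILITY `Σ_{n<N} T_n(ρ) ≤ 19/6`**
  (`sum_range_min_div_le` = 8/3, `Σ √klE0·2^{−n} ≤ 2·√klE0 ≤ 1/2`), `Ioc` form, and **`klTwoShellProfile_pred_le : T_{n−1}(ρ) ≤ 4·T_n(ρ)`**
  (the pen's draft profile `min 1 (Λₙ/(ρ ⊔ Λₙ))` is NOT uniformly summable — `#{n : Λₙ ≥ ρ} ~ log(1/ρ)` — hence the `klRelGain`-type near branch);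
* §2 **`GeoConsts.addTwoShell G A := {G with phGain := phGain + A·T, ppGain := ppGain + A·T, CF := CF + 4A}`**, `rfl` field rows (`cE4`, `S`, … untouched),
  `phGain_le_addTwoShell`, `ppGain_le_addTwoShell`, `CF_le_addTwoShell`, **`addTwoShell_wf`** (`0 ≤ A`: both gain-sum clauses survive with `CF + 4A`),
  **`twoShell_le_addTwoShell_phGain/_ppGain`** (`A·T_n(ρ) ≤` the amended gain — the value closer's booking line), **`addTwoShell_phGain_pred_le`**,
  `thermalBar_le_addTwoShell`, `isoTupleL1AtV17F_addTwoShell_of`, and the commutations `addTwoShell_addShellLog_comm`, `addTwoShell_raiseCF_comm`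
  (so a token `((G.addShellLog C).raiseCF x).addTwoShell A` is PROPOSITIONALLY `((G.raiseCF x).addTwoShell A).addShellLog C` — p1's `…sameShellLog` hosting applies).
The deferred two-shell PACKAGE `A` and the token `klEngGeo11` are NOT here (they follow the ∃-opacity sweep's outcome, `…EngineV8DefsG11`).
Real arithmetic only; nothing about the model is asserted; nothing asserts superconductivity.
-/

noncomputable section

namespace Summit.HubbardSuperconductivity.HubbardSuperconductivity.Theorems.KLRegimeSplit

set_option linter.dupNamespace false -- summit = problem name (single-conjunct summit), D-0017

open Real Finset Literature.MathematicalPhysics.QuantumLattice Literature.Probability.LatticeModels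
open Summit.HubbardSuperconductivity.HubbardSuperconductivity.Theorems.KLProgrammeLegKernels
open Summit.HubbardSuperconductivity.HubbardSuperconductivity.Theorems.DispersionFlow
open Summit.HubbardSuperconductivity.HubbardSuperconductivity.Theorems.EngineV8

/-! ## §1 The two-shell profile: readings, uniform summability, `pred_le` -/

/-- **`klTwoShellProfile n ρ := min(ρ₊/Λₙ, Λₙ/ρ₊) + √klE0·2^{−n}`** (`ρ₊ = max ρ 0`, `Λₙ = klScale klE0 n`). -/
def klTwoShellProfile (n : ℕ) (ρ : ℝ) : ℝ :=
  min (max ρ 0 / klScale klE0 n) (klScale klE0 n / max ρ 0) + Real.sqrt klE0 * ((2 : ℝ) ^ n)⁻¹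

/-- `√klE0 ≤ 1/4` (`klE0 = 1/32 ≤ 1/16`). -/
theorem sqrt_klE0_le_quarter : Real.sqrt klE0 ≤ 1 / 4 := by
  rw [show (1 : ℝ) / 4 = Real.sqrt ((1 / 4) ^ 2) by rw [Real.sqrt_sq (by norm_num)]]
  exact Real.sqrt_le_sqrt (by norm_num [klE0])

/-- `0 ≤ min(ρ₊/Λₙ, Λₙ/ρ₊)`. -/
theorem min_div_klScale_nonneg (n : ℕ) (ρ : ℝ) : 0 ≤ min (max ρ 0 / klScale klE0 n) (klScale klE0 n / max ρ 0) := by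
  have hΛ : 0 < klScale klE0 n := klth_klScale_pos n
  have hρ : 0 ≤ max ρ 0 := le_max_right _ _
  exact le_min (by positivity) (by positivity)

/-- `0 ≤ klTwoShellProfile n ρ`. -/
theorem klTwoShellProfile_nonneg (n : ℕ) (ρ : ℝ) : 0 ≤ klTwoShellProfile n ρ := by
  have := min_div_klScale_nonneg n ρ
  have := Real.sqrt_nonneg klE0
  unfold klTwoShellProfile; positivity

/-- **The `Λₙ/ρ` law is read** (`Λₙ ≤ ρ`): `Λₙ/ρ ≤ klTwoShellProfile n ρ`. -/
theorem klScale_div_le_klTwoShellProfile {n : ℕ} {ρ : ℝ} (hρ : klScale klE0 n ≤ ρ) : klScale klE0 n / ρ ≤ klTwoShellProfile n ρ := by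
  have hΛ : 0 < klScale klE0 n := klth_klScale_pos n
  have hρ0 : 0 < ρ := hΛ.trans_le hρ
  have hmax : max ρ 0 = ρ := max_eq_left hρ0.le
  unfold klTwoShellProfile
  rw [hmax]
  have hmin : min (ρ / klScale klE0 n) (klScale klE0 n / ρ) = klScale klE0 n / ρ := by
    refine min_eq_right ?_
    rw [div_le_div_iff₀ hρ0 hΛ]
    nlinarith
  rw [hmin]
  have := Real.sqrt_nonneg klE0
  have : 0 ≤ Real.sqrt klE0 * ((2 : ℝ) ^ n)⁻¹ := by positivity
  linarith

/-- **The `√Λₙ` law is read**: `√(klScale klE0 n) = √klE0·2^{−n} ≤ klTwoShellProfile n ρ`. -/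
theorem sqrt_klScale_le_klTwoShellProfile (n : ℕ) (ρ : ℝ) : Real.sqrt (klScale klE0 n) ≤ klTwoShellProfile n ρ := by
  have h4 : ((4 : ℝ) ^ n)⁻¹ = (((2 : ℝ) ^ n)⁻¹) ^ 2 := by
    rw [show (4 : ℝ) = 2 ^ 2 by norm_num, ← pow_mul, ← inv_pow, ← inv_pow, ← pow_mul, mul_comm]
  have hs : Real.sqrt (klScale klE0 n) = Real.sqrt klE0 * ((2 : ℝ) ^ n)⁻¹ := by
    unfold klScale
    rw [h4, Real.sqrt_mul (by norm_num [klE0]), Real.sqrt_sq (by positivity)]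
  rw [hs]
  unfold klTwoShellProfile
  linarith [min_div_klScale_nonneg n ρ]

/-- `Σ_{n<N} √klE0·2^{−n} ≤ 1/2`. -/
theorem sum_range_sqrt_klE0_mul_le (N : ℕ) : ∑ n ∈ range N, Real.sqrt klE0 * ((2 : ℝ) ^ n)⁻¹ ≤ 1 / 2 := by
  rw [← mul_sum]
  have hC2 : ∑ n ∈ range N, ((2 : ℝ) ^ n)⁻¹ ≤ 2 := by
    have e : ∀ n : ℕ, ((2 : ℝ) ^ n)⁻¹ = ((1 : ℝ) / 2) ^ n := fun n => by rw [one_div, inv_pow]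
    simp_rw [e]
    have hq0 : (0 : ℝ) ≤ 1 / 2 := by norm_num
    have hq1 : (1 : ℝ) / 2 < 1 := by norm_num
    calc ∑ n ∈ range N, ((1 : ℝ) / 2) ^ n ≤ ∑' n : ℕ, ((1 : ℝ) / 2) ^ n :=
          Summable.sum_le_tsum _ (fun i _ => by positivity) (summable_geometric_of_lt_one hq0 hq1)
      _ = 2 := by rw [tsum_geometric_of_lt_one hq0 hq1]; norm_num
  have hs0 := Real.sqrt_nonneg klE0
  calc Real.sqrt klE0 * ∑ n ∈ range N, ((2 : ℝ) ^ n)⁻¹ ≤ (1 / 4) * 2 :=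
        mul_le_mul sqrt_klE0_le_quarter hC2 (sum_nonneg fun i _ => by positivity) (by norm_num)
    _ = 1 / 2 := by norm_num

/-- **UNIFORM SUMMABILITY**: `Σ_{n<N} klTwoShellProfile n ρ ≤ 19/6` for every `ρ` and every `N` (`8/3 + 1/2`). -/
theorem sum_range_klTwoShellProfile_le (N : ℕ) (ρ : ℝ) : ∑ n ∈ range N, klTwoShellProfile n ρ ≤ 19 / 6 := by
  unfold klTwoShellProfile
  rw [sum_add_distrib]
  have h1 := sum_range_min_div_le N (le_max_right ρ 0)
  have h2 := sum_range_sqrt_klE0_mul_le N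
  linarith

/-- The `Ioc` form (what the particle–particle clause of `GeoConsts.WF` sums): `Σ_{n ∈ Ioc t N} klTwoShellProfile n ρ ≤ 19/6`. -/
theorem sum_Ioc_klTwoShellProfile_le (t N : ℕ) (ρ : ℝ) : ∑ n ∈ Ioc t N, klTwoShellProfile n ρ ≤ 19 / 6 := by
  have hsub : Ioc t N ⊆ range (N + 1) := fun n hn => by
    rw [mem_Ioc] at hn; rw [mem_range]; omega
  exact (sum_le_sum_of_subset_of_nonneg hsub fun n _ _ => klTwoShellProfile_nonneg n ρ).trans (sum_range_klTwoShellProfile_le (N + 1) ρ)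

/-- **`pred_le` for the profile**: `klTwoShellProfile (n−1) ρ ≤ 4·klTwoShellProfile n ρ` (three cases on `ρ₊` against `Λₙ`, `4Λₙ`). -/
theorem klTwoShellProfile_pred_le (n : ℕ) (ρ : ℝ) : klTwoShellProfile (n - 1) ρ ≤ 4 * klTwoShellProfile n ρ := by
  rcases Nat.eq_zero_or_pos n with h0 | hn
  · subst h0
    simp only [Nat.zero_sub]
    linarith [klTwoShellProfile_nonneg 0 ρ]
  have hΛ : 0 < klScale klE0 n := klth_klScale_pos n
  have hpred : klScale klE0 (n - 1) = 4 * klScale klE0 n := by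
    unfold klScale
    obtain ⟨m, rfl⟩ : ∃ m, n = m + 1 := ⟨n - 1, by omega⟩
    rw [Nat.add_sub_cancel, pow_succ]
    field_simp
  have h2 : ((2 : ℝ) ^ (n - 1))⁻¹ = 2 * ((2 : ℝ) ^ n)⁻¹ := by
    obtain ⟨m, rfl⟩ : ∃ m, n = m + 1 := ⟨n - 1, by omega⟩
    rw [Nat.add_sub_cancel, pow_succ]
    field_simp
  set r := max ρ 0 with hr
  have hr0 : 0 ≤ r := le_max_right _ _
  have hs0 := Real.sqrt_nonneg klE0
  unfold klTwoShellProfile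
  rw [← hr, hpred, h2]
  -- the min part: `min(r/(4Λ), 4Λ/r) ≤ 4·min(r/Λ, Λ/r)`
  have hmin : min (r / (4 * klScale klE0 n)) (4 * klScale klE0 n / r) ≤ 4 * min (r / klScale klE0 n) (klScale klE0 n / r) := by
    rcases hr0.eq_or_lt with hz | hrpos
    · rw [← hz]; simp
    rw [mul_min_of_nonneg _ _ (by norm_num : (0 : ℝ) ≤ 4)]
    refine le_min ?_ ?_
    · -- `min ≤ r/(4Λ) ≤ 4·(r/Λ)`
      refine (min_le_left _ _).trans ?_
      rw [div_le_iff₀ (by positivity)]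
      have : 4 * (r / klScale klE0 n) * (4 * klScale klE0 n) = 16 * r := by
        field_simp
        ring
      rw [this]; linarith
    · -- `min ≤ 4Λ/r = 4·(Λ/r)`
      refine (min_le_right _ _).trans (le_of_eq ?_)
      ring
  have hsq : Real.sqrt klE0 * (2 * ((2 : ℝ) ^ n)⁻¹) ≤ 4 * (Real.sqrt klE0 * ((2 : ℝ) ^ n)⁻¹) := by
    have : 0 ≤ Real.sqrt klE0 * ((2 : ℝ) ^ n)⁻¹ := by positivity
    nlinarith
  linarith

/-! ## §2 The amendment `GeoConsts.addTwoShell` -/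

/-- **`G.addTwoShell A`** — `G` with BOTH bubble gains amended by `A·klTwoShellProfile` and `CF := CF + 4A`; every other field untouched. -/
def GeoConsts.addTwoShell (G : GeoConsts) (A : ℝ) : GeoConsts :=
  { G with
    phGain := fun n ρ => G.phGain n ρ + A * klTwoShellProfile n ρ
    ppGain := fun n ρ => G.ppGain n ρ + A * klTwoShellProfile n ρ
    CF := G.CF + 4 * A }

namespace GeoConsts

variable (G : GeoConsts) (A : ℝ)

/-- the amended ph gain -/
theorem addTwoShell_phGain (n : ℕ) (ρ : ℝ) : (G.addTwoShell A).phGain n ρ = G.phGain n ρ + A * klTwoShellProfile n ρ := rfl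
/-- the amended pp gain -/
theorem addTwoShell_ppGain (n : ℕ) (ρ : ℝ) : (G.addTwoShell A).ppGain n ρ = G.ppGain n ρ + A * klTwoShellProfile n ρ := rfl
/-- the amended freezing constant -/
theorem addTwoShell_CF : (G.addTwoShell A).CF = G.CF + 4 * A := rfl
/-- untouched field `cE4`. -/
theorem addTwoShell_cE4 : (G.addTwoShell A).cE4 = G.cE4 := rfl
/-- untouched field `atop`. -/
theorem addTwoShell_atop : (G.addTwoShell A).atop = G.atop := rfl
/-- untouched field `abot`. -/
theorem addTwoShell_abot : (G.addTwoShell A).abot = G.abot := rfl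
/-- untouched field `blo`. -/
theorem addTwoShell_blo : (G.addTwoShell A).blo = G.blo := rfl
/-- untouched field `bhi`. -/
theorem addTwoShell_bhi : (G.addTwoShell A).bhi = G.bhi := rfl
/-- untouched field `cloc`. -/
theorem addTwoShell_cloc : (G.addTwoShell A).cloc = G.cloc := rfl
/-- untouched field `θ`. -/
theorem addTwoShell_θ : (G.addTwoShell A).θ = G.θ := rfl
/-- untouched field `a`. -/
theorem addTwoShell_a : (G.addTwoShell A).a = G.a := rfl
/-- untouched field `ζ`. -/
theorem addTwoShell_ζ : (G.addTwoShell A).ζ = G.ζ := rfl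
/-- untouched field `Z`. -/
theorem addTwoShell_Z : (G.addTwoShell A).Z = G.Z := rfl
/-- untouched field `aplus`. -/
theorem addTwoShell_aplus : (G.addTwoShell A).aplus = G.aplus := rfl
/-- untouched field `S`. -/
theorem addTwoShell_S : (G.addTwoShell A).S = G.S := rfl
/-- untouched field `Bf`. -/
theorem addTwoShell_Bf : (G.addTwoShell A).Bf = G.Bf := rfl
/-- untouched field `SL`. -/
theorem addTwoShell_SL : (G.addTwoShell A).SL = G.SL := rfl

variable {G A}

/-- The ph gain grows (`0 ≤ A`). -/
theorem phGain_le_addTwoShell (hA : 0 ≤ A) (n : ℕ) (ρ : ℝ) : G.phGain n ρ ≤ (G.addTwoShell A).phGain n ρ := by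
  rw [addTwoShell_phGain]
  have := klTwoShellProfile_nonneg n ρ
  nlinarith

/-- The pp gain grows (`0 ≤ A`). -/
theorem ppGain_le_addTwoShell (hA : 0 ≤ A) (n : ℕ) (ρ : ℝ) : G.ppGain n ρ ≤ (G.addTwoShell A).ppGain n ρ := by
  rw [addTwoShell_ppGain]
  have := klTwoShellProfile_nonneg n ρ
  nlinarith

/-- The freezing constant grows (`0 ≤ A`). -/
theorem CF_le_addTwoShell (hA : 0 ≤ A) : G.CF ≤ (G.addTwoShell A).CF := by
  rw [addTwoShell_CF]; linarith

/-- **THE BOOKING LINE (ph)**: `A·klTwoShellProfile n ρ ≤ (G.addTwoShell A).phGain n ρ` (`0 ≤ G.phGain n ρ`). -/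
theorem twoShell_le_addTwoShell_phGain {n : ℕ} {ρ : ℝ} (hph : 0 ≤ G.phGain n ρ) : A * klTwoShellProfile n ρ ≤ (G.addTwoShell A).phGain n ρ := by
  rw [addTwoShell_phGain]; linarith

/-- **THE BOOKING LINE (pp)**: `A·klTwoShellProfile n ρ ≤ (G.addTwoShell A).ppGain n ρ` (`0 ≤ G.ppGain n ρ`). -/
theorem twoShell_le_addTwoShell_ppGain {n : ℕ} {ρ : ℝ} (hpp : 0 ≤ G.ppGain n ρ) : A * klTwoShellProfile n ρ ≤ (G.addTwoShell A).ppGain n ρ := by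
  rw [addTwoShell_ppGain]; linarith

/-- **The amendment preserves well-formedness** (`0 ≤ A`): both gain-sum clauses survive with `CF + 4A` (`Σ T ≤ 19/6 ≤ 4`). -/
theorem addTwoShell_wf (hG : G.WF) (hA : 0 ≤ A) : (G.addTwoShell A).WF := by
  obtain ⟨h1, h2, h3, h4, h5, h6, h7, h8, h9, h10, h11, h12, h13, h14, h15, h16, h17, h18, h19, h20⟩ := hG
  refine ⟨h1, h2, h3, h4, h5, h6, h7, h8, h9, h10, h11, ?_, ?_, ?_, ?_, ?_, h17, h18, h19, h20⟩
  · intro n ρ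
    show 0 ≤ G.ppGain n ρ + A * klTwoShellProfile n ρ
    have := klTwoShellProfile_nonneg n ρ
    have := h12 n ρ
    positivity
  · intro n ρ
    show 0 ≤ G.phGain n ρ + A * klTwoShellProfile n ρ
    have := klTwoShellProfile_nonneg n ρ
    have := h13 n ρ
    positivity
  · show 0 ≤ G.CF + 4 * A
    linarith
  · intro ρ N hρ
    show ∑ n ∈ range N, (G.phGain n ρ + A * klTwoShellProfile n ρ) ≤ G.CF + 4 * A
    rw [sum_add_distrib, ← mul_sum]
    have hS := sum_range_klTwoShellProfile_le N ρ
    have hT : A * ∑ n ∈ range N, klTwoShellProfile n ρ ≤ A * 4 := mul_le_mul_of_nonneg_left (hS.trans (by norm_num)) hA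
    linarith [h15 ρ N hρ]
  · intro ρ t N hρ
    show ∑ n ∈ Ioc t N, (G.ppGain n ρ + A * klTwoShellProfile n ρ) ≤ G.CF + 4 * A
    rw [sum_add_distrib, ← mul_sum]
    have hS := sum_Ioc_klTwoShellProfile_le t N ρ
    have hT : A * ∑ n ∈ Ioc t N, klTwoShellProfile n ρ ≤ A * 4 := mul_le_mul_of_nonneg_left (hS.trans (by norm_num)) hA
    linarith [h16 ρ t N hρ]

/-- **`pred_le` survives**: `G.phGain (n−1) ρ ≤ 4·G.phGain n ρ → (G.addTwoShell A).phGain (n−1) ρ ≤ 4·(G.addTwoShell A).phGain n ρ` (`0 ≤ A`). -/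
theorem addTwoShell_phGain_pred_le (hA : 0 ≤ A) {n : ℕ} {ρ : ℝ} (h : G.phGain (n - 1) ρ ≤ 4 * G.phGain n ρ) :
    (G.addTwoShell A).phGain (n - 1) ρ ≤ 4 * (G.addTwoShell A).phGain n ρ := by
  rw [addTwoShell_phGain, addTwoShell_phGain]
  have hp := mul_le_mul_of_nonneg_left (klTwoShellProfile_pred_le n ρ) hA
  nlinarith

/-- **`addTwoShell` commutes with `addShellLog`** (the gains add in either order; the `CF` sums re-associate). -/
theorem addTwoShell_addShellLog_comm (G : GeoConsts) (C A : ℝ) : (G.addShellLog C).addTwoShell A = (G.addTwoShell A).addShellLog C := by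
  unfold GeoConsts.addTwoShell GeoConsts.addShellLog
  congr 1
  · funext n ρ; ring
  · ring

/-- **`addTwoShell` commutes with `raiseCF`**. -/
theorem addTwoShell_raiseCF_comm (G : GeoConsts) (x A : ℝ) : (G.raiseCF x).addTwoShell A = (G.addTwoShell A).raiseCF x := by
  unfold GeoConsts.addTwoShell GeoConsts.raiseCF
  congr 1
  ring

end GeoConsts

/-! ### The CF-reading majorant / slots under `addTwoShell` -/

section Slots

variable {L M : ℕ} [NeZero L] [NeZero M] {G : GeoConsts} {P : SplitConsts} {Q : EngConsts} {β U μ : ℝ} {K : TrigPolyC4v} {n : ℕ} (A : ℝ)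

/-- `thermalBar` grows along `addTwoShell` (`0 ≤ A`). -/
theorem thermalBar_le_addTwoShell (hA : 0 ≤ A) (P : SplitConsts) (U β : ℝ) (n : ℕ) :
    thermalBar G P U β n ≤ thermalBar (G.addTwoShell A) P U β n := by
  unfold thermalBar
  rw [GeoConsts.addTwoShell_CF]
  have : 0 ≤ (P.Klam * U) ^ 2 * ((4 : ℝ) ^ (nScales β - n))⁻¹ := by positivity
  nlinarith

/-- (E5-F) lifts along `addTwoShell` (`0 ≤ A`). -/
theorem isoTupleL1AtV17F_addTwoShell_of (hA : 0 ≤ A) (h : IsoTupleL1AtV17F L M G P β U μ n) :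
    IsoTupleL1AtV17F L M (G.addTwoShell A) P β U μ n := by
  intro B hB hvals m hm Ω hΩ x₁
  refine (h B hB hvals m hm Ω hΩ x₁).trans ?_
  rw [GeoConsts.addTwoShell_CF]
  have hK : 0 ≤ (P.Klam * U) ^ 2 := sq_nonneg _
  nlinarith

/-- (E4) does not read the gains or `CF`. -/
theorem engineFirstMoments_addTwoShell_iff :
    EngineFirstMoments L M (G.addTwoShell A) P Q β U μ K n ↔ EngineFirstMoments L M G P Q β U μ K n := Iff.rfl

/-- (E3a-F) reads only `G.S` (untouched). -/
theorem twoLegReadJetsF_addTwoShell_iff :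
    TwoLegReadJetsF L M (G.addTwoShell A) Q β U μ n ↔ TwoLegReadJetsF L M G Q β U μ n := Iff.rfl

end Slots

end Summit.HubbardSuperconductivity.HubbardSuperconductivity.Theorems.KLRegimeSplit

end
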